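import Literature.Geometry.Lorentzian.KerrSchildWaveCauchyProblem
import Literature.Geometry.Lorentzian.KerrEnergyIdentity
import HarnessLib

/-!
# The energy current of the slice normal `N = −(dt)♯` for divergence-form wave operators on
# `ℝ⁴`, its divergence identity, and its coercivity on generalised Kerr–Schild backgrounds

(family `gr`; infrastructure for energy estimates for `KerrSchild.waveOperator`, namespace
`Literature.Geometry.Lorentzian.KerrSchild`)

For a symmetric coefficient field `G = (G^{μν})` on `E4 = ℝ⁴` and a function `w`, write
`p_μ = ∂_μ w`, `Q = G^{αβ} p_α p_β`, `X = G^{0α} p_α` (`= g(dt, dw)`). The **energy current of the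
covector `dt`** is the contraction of the stress–energy tensor of `w` with `dt`,
`P^μ = T^{μ0} = G^{μν} p_ν X − ½ G^{0μ} Q` (`KerrSchild.normalCurrent`); its time component
`P⁰ = T^{00} = T(dt, dt)` is the energy density measured by the (past-directed) normal `∇t` of the
slices `{t = const}`, i.e. by Sbierski's vector field `N = −(dt)♯` up to orientation
(Sbierski, Anal. PDE 8 (2015), §7A: "`N := −(dt*)♯`"). This file proves:

* `KerrSchild.sum_fderiv_normalCurrent` — the **divergence identity**
  `∑_μ ∂_μ P^μ = (□_G w) X + R`, where `□_G w = ∑_μ ∂_μ (G^{μν} ∂_ν w)` is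
  `KerrSchild.waveOperator` and `R = KerrSchild.deformationTerm G w` is the quadratic form in `dw`
  with coefficients `∂G` (`R = G^{μα} ∂_μG^{0β} p_α p_β − ½ (∂_μ G^{0μ}) Q − ½ G^{0μ} ∂_μG^{αβ} p_α p_β`;
  the second derivatives of `w` cancel by the symmetry of `G` and of `D²w`). This is the
  coordinate form (`det g = −1`, so `∇_μ J^μ = ∂_μ J^μ`) of
  `∇^μ (T_{μν} V^ν) = (□_g w) V(w) + T_{μν} ∇^μ V^ν` for `V = ∇t` (Dafermos–Rodnianski,
  arXiv:0811.0354, App. D; Alinhac, *Hyperbolic PDE* (2009), Ch. 7 (the energy inequality by the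
  multiplier method)).
* On a generalised Kerr–Schild background `B` (`g⁻¹ = η⁻¹ − φ ℓ♯ ⊗ ℓ♯`, `0 ≤ φ ≤ Φ`, `ℓ` null with
  `ℓ(∂_t) = 1` where `φ ≠ 0`; `KerrSchild.Background`):
  `P⁰ = ½ X² + ½ (1 + φ) |p⃗|² − ½ φ (ℓ⃗ · p⃗)²` (`normalCurrent_zero_eq`), hence the **coercivity**
  `∑_μ p_μ² ≤ 6 P⁰` (`sum_sq_le_six_mul_normalCurrent_zero`) and the bounds `X² ≤ 2 P⁰`,
  `P⁰ ≤ 3 (1 + Φ)² ∑_μ p_μ²`, `|G^{μν}| ≤ 1 + Φ`, and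
  `|R| ≤ 32 (1 + Φ) D ∑_μ p_μ²` wherever `|∂_μ G^{αβ}| ≤ D` (`abs_deformationTerm_le`).

These are the pointwise ingredients of the energy estimate
`E(τ) ≤ K (E(0) + ‖□_G w‖²_{L²([0,T] × ℝ³)})` of `KerrSchildEnergyEstimate.lean`.

## References

* M. Dafermos, I. Rodnianski, *Lectures on black holes and linear waves*, arXiv:0811.0354, App. D
  (`J^V_μ = T_{μν} V^ν`, `K^V`, `𝓔^V`, the divergence identity) (key `DafermosRodnianski2008`).
* S. Alinhac, *Hyperbolic partial differential equations*, Springer 2009, Ch. 7 (energy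
  inequality for variable-coefficient wave equations by the multiplier method).
* J. Sbierski, Anal. PDE 8 (2015) 1379–1420 (arXiv:1311.2477), §2 (proof of Thm. 2.1: the energy
  estimate for `J^N`) and §7A (`N = −(dt*)♯`) (key `Sbierski2015`).
* R. P. Kerr, A. Schild, 1965, §2 (`g⁻¹ = η⁻¹ − φ ℓ♯ ⊗ ℓ♯`) (key `KerrSchild1965`).
-/

noncomputable section

open Set Filter
open scoped ContDiff Topology

namespace Literature.Geometry.Lorentzian

namespace KerrSchild

/-! ### The current `T^{μ0}` and the deformation term -/

/-- The **energy current of the covector `dt`** for the divergence-form wave operator of a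
coefficient field `G`: `P^μ = T^{μ0}[w] = (∑_ν G^{μν} ∂_νw)(∑_α G^{0α} ∂_αw) −
½ G^{0μ} ∑_{αβ} G^{αβ} ∂_αw ∂_βw`, i.e. `J^V_μ = T_{μν} V^ν` with `V = (dt)♯ = ∇t` and the first
index raised (Dafermos–Rodnianski arXiv:0811.0354, App. D; for `V = ∂_t` instead this is
`Kerr.tCurrent`). Its time component is the `T(dt, dt)`-energy density of Sbierski's
`N = −(dt*)♯` (Anal. PDE 8 (2015), §7A). [cite: DafermosRodnianski2008, App. D] -/
def normalCurrent (G : E4 → Fin 4 → Fin 4 → ℝ) (w : E4 → ℝ) (x : E4) (μ : Fin 4) : ℝ :=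
  (∑ ν, G x μ ν * fderiv ℝ w x (E4.basisVector ν)) *
      (∑ α, G x 0 α * fderiv ℝ w x (E4.basisVector α)) -
    2⁻¹ * G x 0 μ *
      ∑ α, ∑ β, G x α β * fderiv ℝ w x (E4.basisVector α) * fderiv ℝ w x (E4.basisVector β)

/-- The **deformation (bulk) term** of the `dt`-current: the quadratic form in `dw` with
coefficients `∂G`,
`R = ∑_μ (∑_ν G^{μν}∂_νw)(∑_β ∂_μG^{0β} ∂_βw) − ½ (∑_μ ∂_μG^{0μ}) ∑_{αβ} G^{αβ}∂_αw∂_βw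
 − ½ ∑_μ G^{0μ} ∑_{αβ} ∂_μG^{αβ} ∂_αw ∂_βw`
(the terms `K^V + …` of `∇^μ J^V_μ = K^V + 𝓔^V`, `K^V = T_{μν}∇^μV^ν`, for `V = ∇t` in coordinates
with `det g = −1`; Dafermos–Rodnianski arXiv:0811.0354, App. D). [cite: DafermosRodnianski2008, App. D] -/
def deformationTerm (G : E4 → Fin 4 → Fin 4 → ℝ) (w : E4 → ℝ) (x : E4) : ℝ :=
  (∑ μ, (∑ ν, G x μ ν * fderiv ℝ w x (E4.basisVector ν)) *
      ∑ β, fderiv ℝ (fun y ↦ G y 0 β) x (E4.basisVector μ) * fderiv ℝ w x (E4.basisVector β)) -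
    2⁻¹ * (∑ μ, fderiv ℝ (fun y ↦ G y 0 μ) x (E4.basisVector μ)) *
      (∑ α, ∑ β, G x α β * fderiv ℝ w x (E4.basisVector α) * fderiv ℝ w x (E4.basisVector β)) -
    2⁻¹ * ∑ μ, G x 0 μ * ∑ α, ∑ β, fderiv ℝ (fun y ↦ G y α β) x (E4.basisVector μ) *
      fderiv ℝ w x (E4.basisVector α) * fderiv ℝ w x (E4.basisVector β)

/-- The current is quadratic in `dw`: it vanishes where `dw = 0`. [folklore] -/
theorem normalCurrent_eq_zero_of_fderiv_eq_zero (G : E4 → Fin 4 → Fin 4 → ℝ) {w : E4 → ℝ}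
    {x : E4} (h : fderiv ℝ w x = 0) (μ : Fin 4) : normalCurrent G w x μ = 0 := by
  simp [normalCurrent, h]

/-- The deformation term is quadratic in `dw`: it vanishes where `dw = 0`. [folklore] -/
theorem deformationTerm_eq_zero_of_fderiv_eq_zero (G : E4 → Fin 4 → Fin 4 → ℝ) {w : E4 → ℝ}
    {x : E4} (h : fderiv ℝ w x = 0) : deformationTerm G w x = 0 := by
  simp [deformationTerm, h]

/-- The pure index algebra behind the cancellation of the second derivatives in
`∑_μ ∂_μ T^{μ0}`: for symmetric `g` and `H`,
`∑_μ (∑_ν g_{μν} P_ν)(∑_β g_{0β} H_{μβ}) = ½ ∑_μ g_{0μ} ∑_{αβ} (g_{αβ} P_α H_{μβ} + P_β g_{αβ} H_{μα})`.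
[folklore] -/
theorem sum_cancel_aux (g H : Fin 4 → Fin 4 → ℝ) (P : Fin 4 → ℝ) (hg : ∀ μ ν, g μ ν = g ν μ)
    (hH : ∀ μ ν, H μ ν = H ν μ) :
    ∑ μ, (∑ ν, g μ ν * P ν) * ∑ β, g 0 β * H μ β =
      2⁻¹ * ∑ μ, g 0 μ * ∑ α, ∑ β, (g α β * P α * H μ β + P β * (g α β * H μ α)) := by
  have g10 := hg 1 0; have g20 := hg 2 0; have g30 := hg 3 0
  have g21 := hg 2 1; have g31 := hg 3 1; have g32 := hg 3 2
  have H10 := hH 1 0; have H20 := hH 2 0; have H30 := hH 3 0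
  have H21 := hH 2 1; have H31 := hH 3 1; have H32 := hH 3 2
  simp only [Fin.sum_univ_four, Fin.isValue]
  rw [g10, g20, g30, g21, g31, g32, H10, H20, H30, H21, H31, H32]
  ring

/-- The pure index algebra of `∑_μ ∂_μ T^{μ0} = (□w) X + R`: with `g` the coefficients, `dg μ α β`
standing for `∂_μ g^{αβ}`, `p` for `dw`, `H` for `D²w` and `dA μ` for `∂_μ(∑_ν g^{μν} p_ν)`, the
product-rule expansion of `∑_μ ∂_μ P^μ` equals `(∑_μ dA_μ) X + R` as soon as `g` and `H` are
symmetric (`sum_cancel_aux`). [folklore] -/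
theorem sum_fderiv_normalCurrent_aux (g H : Fin 4 → Fin 4 → ℝ) (dg : Fin 4 → Fin 4 → Fin 4 → ℝ)
    (p dA : Fin 4 → ℝ) (hg : ∀ μ ν, g μ ν = g ν μ) (hH : ∀ μ ν, H μ ν = H ν μ) :
    ∑ μ, ((∑ ν, g μ ν * p ν) * ∑ ν, (g 0 ν * H μ ν + p ν * dg μ 0 ν) +
        (∑ α, g 0 α * p α) * dA μ -
        (2⁻¹ * g 0 μ * ∑ α, ∑ β, (g α β * p α * H μ β + p β * (g α β * H μ α + p α * dg μ α β)) +
          (∑ α, ∑ β, g α β * p α * p β) * (2⁻¹ * dg μ 0 μ))) =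
      (∑ μ, dA μ) * (∑ α, g 0 α * p α) +
        ((∑ μ, (∑ ν, g μ ν * p ν) * ∑ β, dg μ 0 β * p β) -
          2⁻¹ * (∑ μ, dg μ 0 μ) * (∑ α, ∑ β, g α β * p α * p β) -
          2⁻¹ * ∑ μ, g 0 μ * ∑ α, ∑ β, dg μ α β * p α * p β) := by
  have hcancel := sum_cancel_aux g H p hg hH
  -- split the left-hand side into the cancelling part and the rest
  have hsplit : ∀ μ, (∑ ν, g μ ν * p ν) * ∑ ν, (g 0 ν * H μ ν + p ν * dg μ 0 ν) +
      (∑ α, g 0 α * p α) * dA μ -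
      (2⁻¹ * g 0 μ * ∑ α, ∑ β, (g α β * p α * H μ β + p β * (g α β * H μ α + p α * dg μ α β)) +
        (∑ α, ∑ β, g α β * p α * p β) * (2⁻¹ * dg μ 0 μ)) =
      ((∑ ν, g μ ν * p ν) * ∑ β, g 0 β * H μ β -
        2⁻¹ * (g 0 μ * ∑ α, ∑ β, (g α β * p α * H μ β + p β * (g α β * H μ α)))) +
      ((∑ ν, g μ ν * p ν) * ∑ β, dg μ 0 β * p β + dA μ * (∑ α, g 0 α * p α) -
        2⁻¹ * dg μ 0 μ * (∑ α, ∑ β, g α β * p α * p β) -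
        2⁻¹ * (g 0 μ * ∑ α, ∑ β, dg μ α β * p α * p β)) := by
    intro μ
    have e1 : ∑ ν, (g 0 ν * H μ ν + p ν * dg μ 0 ν) =
        ∑ β, g 0 β * H μ β + ∑ β, dg μ 0 β * p β := by
      rw [← Finset.sum_add_distrib]
      exact Finset.sum_congr rfl fun β _ ↦ by ring
    have e2 : ∑ α, ∑ β, (g α β * p α * H μ β + p β * (g α β * H μ α + p α * dg μ α β)) =
        ∑ α, ∑ β, (g α β * p α * H μ β + p β * (g α β * H μ α)) +
          ∑ α, ∑ β, dg μ α β * p α * p β := by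
      rw [← Finset.sum_add_distrib]
      refine Finset.sum_congr rfl fun α _ ↦ ?_
      rw [← Finset.sum_add_distrib]
      exact Finset.sum_congr rfl fun β _ ↦ by ring
    rw [e1, e2]
    ring
  rw [Finset.sum_congr rfl fun μ _ ↦ hsplit μ, Finset.sum_add_distrib]
  have hC : ∑ μ, ((∑ ν, g μ ν * p ν) * ∑ β, g 0 β * H μ β -
      2⁻¹ * (g 0 μ * ∑ α, ∑ β, (g α β * p α * H μ β + p β * (g α β * H μ α)))) = 0 := by
    rw [Finset.sum_sub_distrib, ← Finset.mul_sum, hcancel, sub_self]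
  rw [hC, zero_add, Finset.sum_sub_distrib, Finset.sum_sub_distrib, Finset.sum_add_distrib,
    ← Finset.sum_mul, ← Finset.sum_mul, ← Finset.mul_sum, ← Finset.mul_sum]
  ring

/-- **The divergence identity for the `dt`-current**: for a coefficient field `G` which is
differentiable and symmetric at `x` and `w` of class `C²` at `x`,
`∑_μ ∂_μ P^μ (x) = (□_G w)(x) · (∑_α G^{0α} ∂_αw)(x) + R(x)` with `□_G = KerrSchild.waveOperator G`
and `R = KerrSchild.deformationTerm G w` — the coordinate form of
`∇^μ(T_{μν}V^ν) = (□_g w) V(w) + T_{μν}∇^μV^ν`, `V = ∇t` (Dafermos–Rodnianski arXiv:0811.0354,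
App. D), the terms with `D²w` cancelling by the symmetry of `G` and of `D²w`.
[cite: DafermosRodnianski2008, App. D] -/
theorem sum_fderiv_normalCurrent {G : E4 → Fin 4 → Fin 4 → ℝ} {w : E4 → ℝ} {x : E4}
    (hG : ∀ μ ν, DifferentiableAt ℝ (fun y ↦ G y μ ν) x) (hsymm : ∀ μ ν, G x μ ν = G x ν μ)
    (hw : ContDiffAt ℝ 2 w x) :
    ∑ μ, fderiv ℝ (fun y ↦ normalCurrent G w y μ) x (E4.basisVector μ) =
      waveOperator G w x * (∑ α, G x 0 α * fderiv ℝ w x (E4.basisVector α)) +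
        deformationTerm G w x := by
  -- abbreviations
  set P : Fin 4 → E4 → ℝ := fun κ y ↦ fderiv ℝ w y (E4.basisVector κ) with hP
  set A : Fin 4 → E4 → ℝ := fun μ y ↦ ∑ ν, G y μ ν * P ν y with hA
  set Q : E4 → ℝ := fun y ↦ ∑ α, ∑ β, G y α β * P α y * P β y with hQ
  set H : Fin 4 → Fin 4 → ℝ := fun μ β ↦ fderiv ℝ (fderiv ℝ w) x (E4.basisVector μ)
    (E4.basisVector β) with hH
  have hw2 : DifferentiableAt ℝ (fderiv ℝ w) x :=
    (hw.fderiv_right (m := 1) le_rfl).differentiableAt one_ne_zero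
  have hHsymm : ∀ μ ν, H μ ν = H ν μ := fun μ ν ↦ (hw.isSymmSndFDerivAt (by simp)).eq _ _
  -- derivative data
  have hdP : ∀ κ, HasFDerivAt (P κ) ((fderiv ℝ (fderiv ℝ w) x).flip (E4.basisVector κ)) x := by
    intro κ
    have := hw2.hasFDerivAt.clm_apply (hasFDerivAt_const (E4.basisVector κ) x)
    simpa using this
  have hdg : ∀ μ ν, HasFDerivAt (fun y ↦ G y μ ν) (fderiv ℝ (fun y ↦ G y μ ν) x) x :=
    fun μ ν ↦ (hG μ ν).hasFDerivAt
  have hdA : ∀ μ, HasFDerivAt (A μ) (∑ ν, (G x μ ν • (fderiv ℝ (fderiv ℝ w) x).flip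
      (E4.basisVector ν) + P ν x • fderiv ℝ (fun y ↦ G y μ ν) x)) x :=
    fun μ ↦ HasFDerivAt.fun_sum fun ν _ ↦ (hdg μ ν).mul (hdP ν)
  have hdQ : HasFDerivAt Q (∑ α, ∑ β,
      ((G x α β * P α x) • (fderiv ℝ (fderiv ℝ w) x).flip (E4.basisVector β) +
        P β x • (G x α β • (fderiv ℝ (fderiv ℝ w) x).flip (E4.basisVector α) +
          P α x • fderiv ℝ (fun y ↦ G y α β) x))) x :=
    HasFDerivAt.fun_sum (u := Finset.univ) fun α (_ : α ∈ Finset.univ) ↦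
      HasFDerivAt.fun_sum (u := Finset.univ) fun β (_ : β ∈ Finset.univ) ↦
        ((hdg α β).mul (hdP α)).mul (hdP β)
  -- the current, componentwise, as a combination of `A μ`, `A 0`, `G _ 0 μ`, `Q`
  have hJ : ∀ μ, (fun y ↦ normalCurrent G w y μ) =
      fun y ↦ A μ y * A 0 y - 2⁻¹ * G y 0 μ * Q y := fun μ ↦ rfl
  have hdJ : ∀ μ, HasFDerivAt (fun y ↦ normalCurrent G w y μ)
      (A μ x • (∑ ν, (G x 0 ν • (fderiv ℝ (fderiv ℝ w) x).flip (E4.basisVector ν) +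
          P ν x • fderiv ℝ (fun y ↦ G y 0 ν) x)) +
        A 0 x • fderiv ℝ (A μ) x -
        ((2⁻¹ * G x 0 μ) • (∑ α, ∑ β,
            ((G x α β * P α x) • (fderiv ℝ (fderiv ℝ w) x).flip (E4.basisVector β) +
              P β x • (G x α β • (fderiv ℝ (fderiv ℝ w) x).flip (E4.basisVector α) +
                P α x • fderiv ℝ (fun y ↦ G y α β) x))) +
          Q x • ((2⁻¹ : ℝ) • fderiv ℝ (fun y ↦ G y 0 μ) x))) x := by
    intro μ
    rw [hJ μ]
    exact ((hdA μ).differentiableAt.hasFDerivAt.mul (hdA 0)).sub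
      (((hdg 0 μ).const_mul 2⁻¹).mul hdQ)
  -- the wave operator is `∑_μ ∂_μ A μ`
  have hbox : waveOperator G w x = ∑ μ, fderiv ℝ (A μ) x (E4.basisVector μ) := rfl
  rw [hbox]
  simp only [fun μ ↦ (hdJ μ).fderiv]
  simp only [sub_apply, add_apply, smul_apply, sum_apply, smul_eq_mul,
    ContinuousLinearMap.flip_apply]
  -- name the second derivatives
  have hHμ : ∀ μ β, fderiv ℝ (fderiv ℝ w) x (E4.basisVector μ) (E4.basisVector β) = H μ β :=
    fun μ β ↦ rfl
  simp only [hHμ]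
  -- the remaining identity is pure index algebra (`sum_fderiv_normalCurrent_aux`)
  rw [deformationTerm]
  simp only [hA, hQ, hP]
  exact sum_fderiv_normalCurrent_aux (G x) H
    (fun μ α β ↦ fderiv ℝ (fun y ↦ G y α β) x (E4.basisVector μ))
    (fun ν ↦ fderiv ℝ w x (E4.basisVector ν))
    (fun μ ↦ fderiv ℝ (fun y ↦ ∑ ν, G y μ ν * fderiv ℝ w y (E4.basisVector ν)) x
      (E4.basisVector μ)) hsymm hHsymm

/-! ### Symmetry and size of generalised Kerr–Schild coefficients -/

/-- `|l^μ| ≤ 1` for an `η`-null vector with `η(l, ∂_t) = 1` (`l⁰ = −1`, `|l⃗| = 1`).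
[cite: KerrSchild1965, §2] -/
theorem abs_l_le_one {l : E4} (hnull : Minkowski.bilin l l = 0)
    (hnorm : Minkowski.bilin l (E4.basisVector 0) = 1) (μ : Fin 4) : |l μ| ≤ 1 := by
  have h0 : l 0 = -1 := by
    rw [Minkowski.bilin_symm, Minkowski.bilin_basisVector_zero_left] at hnorm
    linarith
  have hsp : l 1 ^ 2 + l 2 ^ 2 + l 3 ^ 2 = 1 := by
    have := hnull
    simp only [Minkowski.bilin_apply, Fin.sum_univ_three, Fin.isValue, Fin.succ_zero_eq_one,
      Fin.succ_one_eq_two, h0] at this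
    have h3 : (Fin.succ 2 : Fin 4) = 3 := rfl
    rw [h3] at this
    nlinarith
  have key : ∀ t : ℝ, t ^ 2 ≤ 1 → |t| ≤ 1 := fun t ht ↦
    abs_le_one_iff_mul_self_le_one.mpr (by nlinarith)
  have h1 : |l 1| ≤ 1 := key _ (by nlinarith [sq_nonneg (l 2), sq_nonneg (l 3)])
  have h2 : |l 2| ≤ 1 := key _ (by nlinarith [sq_nonneg (l 1), sq_nonneg (l 3)])
  have h3 : |l 3| ≤ 1 := key _ (by nlinarith [sq_nonneg (l 1), sq_nonneg (l 2)])
  have h0' : |l 0| ≤ 1 := by rw [h0]; norm_num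
  fin_cases μ
  exacts [h0', h1, h2, h3]

/-- `|η^{μν}| ≤ 1`. [folklore] -/
theorem abs_etaComp_le_one (μ ν : Fin 4) : |Kerr.etaComp μ ν| ≤ 1 := by
  unfold Kerr.etaComp
  split_ifs <;> simp

namespace Background

/-- On a background `|g^{μν}| ≤ 1 + Φ` (`|η^{μν}| ≤ 1`, `0 ≤ φ ≤ Φ`, `|l^μ| ≤ 1`).
[cite: KerrSchild1965, §2] -/
theorem abs_inverseMetric_le (B : Background) (x : E4) (μ ν : Fin 4) :
    |B.inverseMetric x μ ν| ≤ 1 + B.bound := by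
  have hΦ : 0 ≤ B.bound := (B.φ_nonneg x).trans (B.φ_le x)
  rw [Background.inverseMetric, KerrSchild.inverseMetric]
  by_cases hx : B.φ x = 0
  · rw [hx, zero_mul, zero_mul, sub_zero]
    exact (abs_etaComp_le_one μ ν).trans (by linarith)
  · have h1 := abs_l_le_one (B.null x hx) (B.normalised x hx) μ
    have h2 := abs_l_le_one (B.null x hx) (B.normalised x hx) ν
    calc |Kerr.etaComp μ ν - B.φ x * B.l x μ * B.l x ν|
        ≤ |Kerr.etaComp μ ν| + |B.φ x * B.l x μ * B.l x ν| := abs_sub _ _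
      _ ≤ 1 + B.bound := by
          refine add_le_add (abs_etaComp_le_one μ ν) ?_
          rw [abs_mul, abs_mul, abs_of_nonneg (B.φ_nonneg x)]
          calc B.φ x * |B.l x μ| * |B.l x ν| ≤ B.bound * 1 * 1 :=
                mul_le_mul (mul_le_mul (B.φ_le x) h1 (abs_nonneg _) hΦ) h2 (abs_nonneg _)
                  (by rw [mul_one]; exact hΦ)
            _ = B.bound := by ring

/-- The inverse metric of a background is symmetric. [cite: KerrSchild1965, §2] -/
theorem inverseMetric_symm (B : Background) (x : E4) (μ ν : Fin 4) :
    B.inverseMetric x μ ν = B.inverseMetric x ν μ :=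
  KerrSchild.inverseMetric_symm _ _ x μ ν

/-- The inverse-metric components of a background are differentiable. [cite: KerrSchild1965, §2] -/
theorem differentiableAt_inverseMetric (B : Background) (x : E4) (μ ν : Fin 4) :
    DifferentiableAt ℝ (fun y ↦ B.inverseMetric y μ ν) x :=
  ((B.contDiff_inverseMetric μ ν).differentiable (by simp)).differentiableAt

/-! ### The energy density `T^{00}` on a background: explicit form and coercivity -/

/-- **`T^{00}` on a generalised Kerr–Schild background**: with `p_μ = ∂_μw`,
`X = ∑_α g^{0α} p_α = −(1 + φ) p₀ + φ (ℓ⃗·p⃗)` and `L = ℓ⃗·p⃗ = ∑_i l^i p_i`,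
`P⁰ = ½ X² + ½ ((1 + φ)(p₁² + p₂² + p₃²) − φ L²)` (expand `g^{μν} = η^{μν} − φ l^μ l^ν` with
`l⁰ = −1`). [cite: KerrSchild1965, §2] -/
theorem normalCurrent_zero_eq (B : Background) (w : E4 → ℝ) (x : E4) :
    normalCurrent B.inverseMetric w x 0 =
      2⁻¹ * (∑ α, B.inverseMetric x 0 α * fderiv ℝ w x (E4.basisVector α)) ^ 2 +
        2⁻¹ * ((1 + B.φ x) * (fderiv ℝ w x (E4.basisVector 1) ^ 2 +
            fderiv ℝ w x (E4.basisVector 2) ^ 2 + fderiv ℝ w x (E4.basisVector 3) ^ 2) -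
          B.φ x * (B.l x 1 * fderiv ℝ w x (E4.basisVector 1) +
            B.l x 2 * fderiv ℝ w x (E4.basisVector 2) +
              B.l x 3 * fderiv ℝ w x (E4.basisVector 3)) ^ 2) := by
  have hl0 : B.φ x = 0 ∨ B.l x 0 = -1 := by
    by_cases hx : B.φ x = 0
    · exact Or.inl hx
    · right
      have hnorm := B.normalised x hx
      rw [Minkowski.bilin_symm, Minkowski.bilin_basisVector_zero_left] at hnorm
      linarith
  -- name the atoms, expand the sums over `Fin 4`, decide the Kronecker deltas
  obtain ⟨p0, hp0⟩ : ∃ p0, fderiv ℝ w x (E4.basisVector 0) = p0 := ⟨_, rfl⟩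
  obtain ⟨p1, hp1⟩ : ∃ p1, fderiv ℝ w x (E4.basisVector 1) = p1 := ⟨_, rfl⟩
  obtain ⟨p2, hp2⟩ : ∃ p2, fderiv ℝ w x (E4.basisVector 2) = p2 := ⟨_, rfl⟩
  obtain ⟨p3, hp3⟩ : ∃ p3, fderiv ℝ w x (E4.basisVector 3) = p3 := ⟨_, rfl⟩
  obtain ⟨l0, hl0'⟩ : ∃ l0, B.l x 0 = l0 := ⟨_, rfl⟩
  obtain ⟨l1, hl1⟩ : ∃ l1, B.l x 1 = l1 := ⟨_, rfl⟩
  obtain ⟨l2, hl2⟩ : ∃ l2, B.l x 2 = l2 := ⟨_, rfl⟩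
  obtain ⟨l3, hl3⟩ : ∃ l3, B.l x 3 = l3 := ⟨_, rfl⟩
  obtain ⟨f, hf⟩ : ∃ f, B.φ x = f := ⟨_, rfl⟩
  rw [hf, hl0'] at hl0
  simp only [normalCurrent, Background.inverseMetric, KerrSchild.inverseMetric, Kerr.etaComp,
    Fin.sum_univ_four, Fin.isValue, hp0, hp1, hp2, hp3, hl0', hl1, hl2, hl3, hf]
  simp only [show (1 : Fin 4) ≠ 0 from by decide, show (2 : Fin 4) ≠ 0 from by decide,
    show (3 : Fin 4) ≠ 0 from by decide, show (0 : Fin 4) ≠ 1 from by decide,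
    show (0 : Fin 4) ≠ 2 from by decide, show (0 : Fin 4) ≠ 3 from by decide,
    show (1 : Fin 4) ≠ 2 from by decide, show (1 : Fin 4) ≠ 3 from by decide,
    show (2 : Fin 4) ≠ 1 from by decide, show (2 : Fin 4) ≠ 3 from by decide,
    show (3 : Fin 4) ≠ 1 from by decide, show (3 : Fin 4) ≠ 2 from by decide, if_true, if_false]
  rcases hl0 with h | h
  · rw [h]; ring
  · rw [h]; ring

/-- **`X² ≤ 2 P⁰` and `p₁² + p₂² + p₃² ≤ 2 P⁰` on a background**: since `0 ≤ φ` and, by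
Cauchy–Schwarz with `|ℓ⃗| = 1`, `L² ≤ |p⃗|²`, one has `P⁰ ≥ ½ X² + ½ |p⃗|²`
(`T(dt, dt) ≥ 0`, the dominant energy condition for the wave stress tensor with the timelike
covector `dt`; Dafermos–Rodnianski arXiv:0811.0354, App. D). [cite: DafermosRodnianski2008, App. D] -/
theorem half_sq_add_half_sq_le_normalCurrent_zero (B : Background) (w : E4 → ℝ) (x : E4) :
    2⁻¹ * (∑ α, B.inverseMetric x 0 α * fderiv ℝ w x (E4.basisVector α)) ^ 2 +
        2⁻¹ * (fderiv ℝ w x (E4.basisVector 1) ^ 2 + fderiv ℝ w x (E4.basisVector 2) ^ 2 +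
          fderiv ℝ w x (E4.basisVector 3) ^ 2) ≤
      normalCurrent B.inverseMetric w x 0 := by
  rw [normalCurrent_zero_eq]
  set p1 := fderiv ℝ w x (E4.basisVector 1)
  set p2 := fderiv ℝ w x (E4.basisVector 2)
  set p3 := fderiv ℝ w x (E4.basisVector 3)
  have hφ := B.φ_nonneg x
  -- `φ L² ≤ φ |p⃗|²`
  have hL : B.φ x * (B.l x 1 * p1 + B.l x 2 * p2 + B.l x 3 * p3) ^ 2 ≤
      B.φ x * (p1 ^ 2 + p2 ^ 2 + p3 ^ 2) := by
    by_cases hx : B.φ x = 0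
    · rw [hx, zero_mul, zero_mul]
    · refine mul_le_mul_of_nonneg_left ?_ hφ
      have h0 : B.l x 0 = -1 := by
        have hnorm := B.normalised x hx
        rw [Minkowski.bilin_symm, Minkowski.bilin_basisVector_zero_left] at hnorm
        linarith
      have hsp : B.l x 1 ^ 2 + B.l x 2 ^ 2 + B.l x 3 ^ 2 = 1 := by
        have := B.null x hx
        simp only [Minkowski.bilin_apply, Fin.sum_univ_three, Fin.isValue, Fin.succ_zero_eq_one,
          Fin.succ_one_eq_two, h0] at this
        have h3 : (Fin.succ 2 : Fin 4) = 3 := rfl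
        rw [h3] at this
        nlinarith
      nlinarith [sq_nonneg (B.l x 1 * p2 - B.l x 2 * p1), sq_nonneg (B.l x 1 * p3 - B.l x 3 * p1),
        sq_nonneg (B.l x 2 * p3 - B.l x 3 * p2)]
  nlinarith

/-- **Coercivity of `T^{00}` on a background**: `∑_μ (∂_μw)² ≤ 6 P⁰`. Indeed
`p₀ = (φ L − X)/(1 + φ)` gives `p₀² ≤ 2 X² + 2 |p⃗|²`, so `∑ p² ≤ 3 |p⃗|² + 2 X² ≤ 6 P⁰` by
`half_sq_add_half_sq_le_normalCurrent_zero` (uniform in `φ ≥ 0`: the slices `{t = const}` are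
uniformly spacelike for `dt`, Choquet-Bruhat–Cotsakis 2002, §2). [cite: ChoquetbruhatCotsakis2002, §2] -/
theorem sum_sq_le_six_mul_normalCurrent_zero (B : Background) (w : E4 → ℝ) (x : E4) :
    ∑ μ, fderiv ℝ w x (E4.basisVector μ) ^ 2 ≤ 6 * normalCurrent B.inverseMetric w x 0 := by
  have hmain := half_sq_add_half_sq_le_normalCurrent_zero B w x
  -- explicit atoms for the four partial derivatives
  obtain ⟨p0, hp0⟩ : ∃ p0, fderiv ℝ w x (E4.basisVector 0) = p0 := ⟨_, rfl⟩
  obtain ⟨p1, hp1⟩ : ∃ p1, fderiv ℝ w x (E4.basisVector 1) = p1 := ⟨_, rfl⟩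
  obtain ⟨p2, hp2⟩ : ∃ p2, fderiv ℝ w x (E4.basisVector 2) = p2 := ⟨_, rfl⟩
  obtain ⟨p3, hp3⟩ : ∃ p3, fderiv ℝ w x (E4.basisVector 3) = p3 := ⟨_, rfl⟩
  have hφ := B.φ_nonneg x
  -- `X = −(1 + φ) p₀ + φ L` and `φ L² ≤ φ |p⃗|²`
  have hXeq : (∑ α, B.inverseMetric x 0 α * fderiv ℝ w x (E4.basisVector α)) =
      -(1 + B.φ x) * p0 + B.φ x * (B.l x 1 * p1 + B.l x 2 * p2 + B.l x 3 * p3) ∧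
      B.φ x * (B.l x 1 * p1 + B.l x 2 * p2 + B.l x 3 * p3) ^ 2 ≤
        B.φ x * (p1 ^ 2 + p2 ^ 2 + p3 ^ 2) := by
    by_cases hx : B.φ x = 0
    · refine ⟨?_, by rw [hx, zero_mul, zero_mul]⟩
      simp only [Background.inverseMetric, KerrSchild.inverseMetric, Kerr.etaComp, hx,
        Fin.sum_univ_four, Fin.isValue, hp0, hp1, hp2, hp3]
      simp only [show (0 : Fin 4) ≠ 1 from by decide, show (0 : Fin 4) ≠ 2 from by decide,
        show (0 : Fin 4) ≠ 3 from by decide, if_true, if_false]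
      ring
    · have h0 : B.l x 0 = -1 := by
        have hnorm := B.normalised x hx
        rw [Minkowski.bilin_symm, Minkowski.bilin_basisVector_zero_left] at hnorm
        linarith
      have hsp : B.l x 1 ^ 2 + B.l x 2 ^ 2 + B.l x 3 ^ 2 = 1 := by
        have := B.null x hx
        simp only [Minkowski.bilin_apply, Fin.sum_univ_three, Fin.isValue, Fin.succ_zero_eq_one,
          Fin.succ_one_eq_two, h0] at this
        have h3 : (Fin.succ 2 : Fin 4) = 3 := rfl
        rw [h3] at this
        nlinarith
      refine ⟨?_, ?_⟩
      · simp only [Background.inverseMetric, KerrSchild.inverseMetric, Kerr.etaComp, h0,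
          Fin.sum_univ_four, Fin.isValue, hp0, hp1, hp2, hp3]
        simp only [show (0 : Fin 4) ≠ 1 from by decide, show (0 : Fin 4) ≠ 2 from by decide,
          show (0 : Fin 4) ≠ 3 from by decide, if_true, if_false]
        ring
      · refine mul_le_mul_of_nonneg_left ?_ hφ
        nlinarith [sq_nonneg (B.l x 1 * p2 - B.l x 2 * p1),
          sq_nonneg (B.l x 1 * p3 - B.l x 3 * p1), sq_nonneg (B.l x 2 * p3 - B.l x 3 * p2)]
  obtain ⟨hXe, hL⟩ := hXeq
  rw [hXe, hp1, hp2, hp3] at hmain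
  set L := B.l x 1 * p1 + B.l x 2 * p2 + B.l x 3 * p3 with hLdef
  set X := -(1 + B.φ x) * p0 + B.φ x * L with hXdef
  -- `(1 + φ) p₀ = φ L − X`, so `(1+φ)² p₀² ≤ 2 φ² L² + 2 X²`, and `φ² L² ≤ φ² |p⃗|² ≤ (1+φ)² |p⃗|²`
  set S' := p1 ^ 2 + p2 ^ 2 + p3 ^ 2 with hS'
  have hS'0 : 0 ≤ S' := by positivity
  obtain ⟨f, hf⟩ : ∃ f, B.φ x = f := ⟨_, rfl⟩
  rw [hf] at hφ hL hXdef
  have hp0sq : p0 ^ 2 ≤ 2 * X ^ 2 + 2 * S' := by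
    have h1 : (1 + f) * p0 = f * L - X := by rw [hXdef]; ring
    have e1 : (f * L - X) ^ 2 ≤ 2 * (f * (f * L ^ 2)) + 2 * X ^ 2 := by
      have key : 2 * (f * (f * L ^ 2)) + 2 * X ^ 2 - (f * L - X) ^ 2 = (f * L + X) ^ 2 := by ring
      linarith only [key, sq_nonneg (f * L + X)]
    have e2 : f * (f * L ^ 2) ≤ f * (f * S') := mul_le_mul_of_nonneg_left hL hφ
    have e3 : f * (f * S') ≤ (1 + f) ^ 2 * S' := by
      have key : (1 + f) ^ 2 * S' - f * (f * S') = (1 + 2 * f) * S' := by ring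
      have hpos : 0 ≤ (1 + 2 * f) * S' := mul_nonneg (by linarith only [hφ]) hS'0
      linarith only [key, hpos]
    have e4 : X ^ 2 ≤ (1 + f) ^ 2 * X ^ 2 := by
      have key : (1 + f) ^ 2 * X ^ 2 - X ^ 2 = f * ((2 + f) * X ^ 2) := by ring
      have hpos : 0 ≤ f * ((2 + f) * X ^ 2) :=
        mul_nonneg hφ (mul_nonneg (by linarith only [hφ]) (sq_nonneg X))
      linarith only [key, hpos]
    have h2 : (1 + f) ^ 2 * p0 ^ 2 ≤ (1 + f) ^ 2 * (2 * X ^ 2 + 2 * S') := by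
      have hsq : (1 + f) ^ 2 * p0 ^ 2 = (f * L - X) ^ 2 := by rw [← h1]; ring
      have hexp : (1 + f) ^ 2 * (2 * X ^ 2 + 2 * S') =
          2 * ((1 + f) ^ 2 * S') + 2 * ((1 + f) ^ 2 * X ^ 2) := by ring
      rw [hsq, hexp]
      linarith only [e1, e2, e3, e4]
    have hpos : 0 < (1 + f) ^ 2 := by positivity
    exact le_of_mul_le_mul_left h2 hpos
  rw [Fin.sum_univ_four, hp0, hp1, hp2, hp3]
  linarith only [hmain, hp0sq, hS', sq_nonneg X]

/-- **Upper bound `P⁰ ≤ 3 (1 + Φ)² ∑_μ (∂_μw)²`** (`X² ≤ 4(1+Φ)² ∑p²`, `(1+φ)|p⃗|² ≤ (1+Φ) ∑p²`,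
`½ (1 + Φ) ≤ (1 + Φ)²`). [cite: KerrSchild1965, §2] -/
theorem normalCurrent_zero_le (B : Background) (w : E4 → ℝ) (x : E4) :
    normalCurrent B.inverseMetric w x 0 ≤
      3 * (1 + B.bound) ^ 2 * ∑ μ, fderiv ℝ w x (E4.basisVector μ) ^ 2 := by
  rw [normalCurrent_zero_eq]
  have hφ := B.φ_nonneg x
  have hΦ := B.φ_le x
  set S := ∑ μ, fderiv ℝ w x (E4.basisVector μ) ^ 2 with hS
  have hS4 : S = fderiv ℝ w x (E4.basisVector 0) ^ 2 + fderiv ℝ w x (E4.basisVector 1) ^ 2 +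
      fderiv ℝ w x (E4.basisVector 2) ^ 2 + fderiv ℝ w x (E4.basisVector 3) ^ 2 := by
    rw [hS, Fin.sum_univ_four]
  have hX : (∑ α, B.inverseMetric x 0 α * fderiv ℝ w x (E4.basisVector α)) ^ 2 ≤
      4 * (1 + B.bound) ^ 2 * S := by
    have h1 : |∑ α, B.inverseMetric x 0 α * fderiv ℝ w x (E4.basisVector α)| ≤
        (1 + B.bound) * ∑ α, |fderiv ℝ w x (E4.basisVector α)| := by
      calc _ ≤ ∑ α, |B.inverseMetric x 0 α * fderiv ℝ w x (E4.basisVector α)| :=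
            Finset.abs_sum_le_sum_abs _ _
        _ ≤ ∑ α, (1 + B.bound) * |fderiv ℝ w x (E4.basisVector α)| := by
            refine Finset.sum_le_sum fun α _ ↦ ?_
            rw [abs_mul]
            exact mul_le_mul_of_nonneg_right (B.abs_inverseMetric_le x 0 α) (abs_nonneg _)
        _ = (1 + B.bound) * ∑ α, |fderiv ℝ w x (E4.basisVector α)| := by rw [Finset.mul_sum]
    have h2 := Kerr.sq_sum_abs_le_four_mul fun α ↦ fderiv ℝ w x (E4.basisVector α)
    have h0 : 0 ≤ (1 + B.bound) * ∑ α, |fderiv ℝ w x (E4.basisVector α)| :=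
      mul_nonneg (by linarith) (Finset.sum_nonneg fun _ _ ↦ abs_nonneg _)
    calc (∑ α, B.inverseMetric x 0 α * fderiv ℝ w x (E4.basisVector α)) ^ 2
        = |∑ α, B.inverseMetric x 0 α * fderiv ℝ w x (E4.basisVector α)| ^ 2 := (sq_abs _).symm
      _ ≤ ((1 + B.bound) * ∑ α, |fderiv ℝ w x (E4.basisVector α)|) ^ 2 :=
          pow_le_pow_left₀ (abs_nonneg _) h1 2
      _ = (1 + B.bound) ^ 2 * (∑ α, |fderiv ℝ w x (E4.basisVector α)|) ^ 2 := by ring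
      _ ≤ (1 + B.bound) ^ 2 * (4 * S) := by rw [hS]; gcongr
      _ = 4 * (1 + B.bound) ^ 2 * S := by ring
  have hsp : (1 + B.φ x) * (fderiv ℝ w x (E4.basisVector 1) ^ 2 +
      fderiv ℝ w x (E4.basisVector 2) ^ 2 + fderiv ℝ w x (E4.basisVector 3) ^ 2) ≤
      (1 + B.bound) * S := by
    rw [hS4]
    have : fderiv ℝ w x (E4.basisVector 1) ^ 2 + fderiv ℝ w x (E4.basisVector 2) ^ 2 +
        fderiv ℝ w x (E4.basisVector 3) ^ 2 ≤ fderiv ℝ w x (E4.basisVector 0) ^ 2 +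
        fderiv ℝ w x (E4.basisVector 1) ^ 2 + fderiv ℝ w x (E4.basisVector 2) ^ 2 +
        fderiv ℝ w x (E4.basisVector 3) ^ 2 := by nlinarith
    calc _ ≤ (1 + B.bound) * (fderiv ℝ w x (E4.basisVector 1) ^ 2 +
          fderiv ℝ w x (E4.basisVector 2) ^ 2 + fderiv ℝ w x (E4.basisVector 3) ^ 2) := by
          gcongr
      _ ≤ _ := mul_le_mul_of_nonneg_left this (by linarith)
  have hL : 0 ≤ B.φ x * (B.l x 1 * fderiv ℝ w x (E4.basisVector 1) +
      B.l x 2 * fderiv ℝ w x (E4.basisVector 2) + B.l x 3 * fderiv ℝ w x (E4.basisVector 3)) ^ 2 :=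
    mul_nonneg hφ (sq_nonneg _)
  have hS0 : 0 ≤ S := Finset.sum_nonneg fun _ _ ↦ sq_nonneg _
  have hΦ0 : 0 ≤ B.bound := hφ.trans hΦ
  have hhalf : 2⁻¹ * ((1 + B.bound) * S) ≤ (1 + B.bound) ^ 2 * S := by
    nlinarith [mul_nonneg hΦ0 hS0, mul_nonneg (mul_nonneg hΦ0 hΦ0) hS0]
  linarith

/-! ### The size of the deformation term -/

/-- **`|R| ≤ 32 (1 + Φ) D ∑_μ (∂_μw)²`** wherever `|∂_μ g^{αβ}| ≤ D`: each of the three pieces of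
`KerrSchild.deformationTerm` is a double sum `∑ a_{αβ} u_α v_β` with `|a| ≤ (1 + Φ) D`-type
bounds (`Kerr.abs_sum_sum_mul_mul_le`, `(∑|p_μ|)² ≤ 4 ∑ p_μ²`). [folklore] -/
theorem abs_deformationTerm_le (B : Background) (w : E4 → ℝ) (x : E4) {D : ℝ} (hD0 : 0 ≤ D)
    (hD : ∀ μ α β, |fderiv ℝ (fun y ↦ B.inverseMetric y α β) x (E4.basisVector μ)| ≤ D) :
    |deformationTerm B.inverseMetric w x| ≤
      32 * (1 + B.bound) * D * ∑ μ, fderiv ℝ w x (E4.basisVector μ) ^ 2 := by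
  set p : Fin 4 → ℝ := fun μ ↦ fderiv ℝ w x (E4.basisVector μ) with hp
  set S := ∑ μ, p μ ^ 2 with hS
  set Φ := B.bound
  have hΦ0 : 0 ≤ Φ := (B.φ_nonneg x).trans (B.φ_le x)
  have hA : ∀ μ ν, |B.inverseMetric x μ ν| ≤ 1 + Φ := B.abs_inverseMetric_le x
  have hsum0 : 0 ≤ ∑ μ, |p μ| := Finset.sum_nonneg fun _ _ ↦ abs_nonneg _
  have hsq : (∑ μ, |p μ|) ^ 2 ≤ 4 * S := Kerr.sq_sum_abs_le_four_mul p
  have hS0 : 0 ≤ S := Finset.sum_nonneg fun _ _ ↦ sq_nonneg _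
  -- `|∑_ν g^{μν} p_ν| ≤ (1+Φ) ∑|p|` and `|∑_β ∂_μ g^{0β} p_β| ≤ D ∑|p|`
  have hAμ : ∀ μ, |∑ ν, B.inverseMetric x μ ν * p ν| ≤ (1 + Φ) * ∑ ν, |p ν| := by
    intro μ
    calc _ ≤ ∑ ν, |B.inverseMetric x μ ν * p ν| := Finset.abs_sum_le_sum_abs _ _
      _ ≤ ∑ ν, (1 + Φ) * |p ν| := Finset.sum_le_sum fun ν _ ↦ by
          rw [abs_mul]; exact mul_le_mul_of_nonneg_right (hA μ ν) (abs_nonneg _)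
      _ = _ := by rw [Finset.mul_sum]
  have hBμ : ∀ μ, |∑ β, fderiv ℝ (fun y ↦ B.inverseMetric y 0 β) x (E4.basisVector μ) * p β| ≤
      D * ∑ β, |p β| := by
    intro μ
    calc _ ≤ ∑ β, |fderiv ℝ (fun y ↦ B.inverseMetric y 0 β) x (E4.basisVector μ) * p β| :=
          Finset.abs_sum_le_sum_abs _ _
      _ ≤ ∑ β, D * |p β| := Finset.sum_le_sum fun β _ ↦ by
          rw [abs_mul]; exact mul_le_mul_of_nonneg_right (hD μ 0 β) (abs_nonneg _)
      _ = _ := by rw [Finset.mul_sum]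
  -- term 1
  have h1 : |∑ μ, (∑ ν, B.inverseMetric x μ ν * p ν) *
      ∑ β, fderiv ℝ (fun y ↦ B.inverseMetric y 0 β) x (E4.basisVector μ) * p β| ≤
      16 * (1 + Φ) * D * S := by
    calc _ ≤ ∑ μ, |(∑ ν, B.inverseMetric x μ ν * p ν) *
          ∑ β, fderiv ℝ (fun y ↦ B.inverseMetric y 0 β) x (E4.basisVector μ) * p β| :=
          Finset.abs_sum_le_sum_abs _ _
      _ ≤ ∑ μ : Fin 4, ((1 + Φ) * ∑ ν, |p ν|) * (D * ∑ β, |p β|) :=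
          Finset.sum_le_sum fun μ _ ↦ by
            rw [abs_mul]
            exact mul_le_mul (hAμ μ) (hBμ μ) (abs_nonneg _) (by positivity)
      _ = 4 * ((1 + Φ) * D * (∑ ν, |p ν|) ^ 2) := by
          rw [Finset.sum_const, Finset.card_univ, Fintype.card_fin]; ring
      _ ≤ 4 * ((1 + Φ) * D * (4 * S)) := by gcongr
      _ = 16 * (1 + Φ) * D * S := by ring
  -- term 2
  have h2 : |2⁻¹ * (∑ μ, fderiv ℝ (fun y ↦ B.inverseMetric y 0 μ) x (E4.basisVector μ)) *
      ∑ α, ∑ β, B.inverseMetric x α β * p α * p β| ≤ 8 * (1 + Φ) * D * S := by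
    have hdiv : |∑ μ, fderiv ℝ (fun y ↦ B.inverseMetric y 0 μ) x (E4.basisVector μ)| ≤ 4 * D :=
      calc _ ≤ ∑ μ, |fderiv ℝ (fun y ↦ B.inverseMetric y 0 μ) x (E4.basisVector μ)| :=
            Finset.abs_sum_le_sum_abs _ _
        _ ≤ ∑ μ : Fin 4, D := Finset.sum_le_sum fun μ _ ↦ hD μ 0 μ
        _ = 4 * D := by rw [Finset.sum_const, Finset.card_univ, Fintype.card_fin]; ring
    have hQ := Kerr.abs_sum_sum_mul_mul_le (B.inverseMetric x) p p hA
    rw [abs_mul, abs_mul, abs_of_pos (by norm_num : (0 : ℝ) < 2⁻¹)]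
    calc 2⁻¹ * |∑ μ, fderiv ℝ (fun y ↦ B.inverseMetric y 0 μ) x (E4.basisVector μ)| *
          |∑ α, ∑ β, B.inverseMetric x α β * p α * p β|
        ≤ 2⁻¹ * (4 * D) * ((1 + Φ) * (∑ μ, |p μ|) * ∑ ν, |p ν|) := by gcongr
      _ = 2 * D * (1 + Φ) * (∑ μ, |p μ|) ^ 2 := by ring
      _ ≤ 2 * D * (1 + Φ) * (4 * S) := by gcongr
      _ = 8 * (1 + Φ) * D * S := by ring
  -- term 3
  have h3 : |2⁻¹ * ∑ μ, B.inverseMetric x 0 μ * ∑ α, ∑ β,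
      fderiv ℝ (fun y ↦ B.inverseMetric y α β) x (E4.basisVector μ) * p α * p β| ≤
      8 * (1 + Φ) * D * S := by
    rw [abs_mul, abs_of_pos (by norm_num : (0 : ℝ) < 2⁻¹)]
    have hin : ∀ μ, |B.inverseMetric x 0 μ * ∑ α, ∑ β,
        fderiv ℝ (fun y ↦ B.inverseMetric y α β) x (E4.basisVector μ) * p α * p β| ≤
        (1 + Φ) * (D * (∑ α, |p α|) * ∑ β, |p β|) := by
      intro μ
      rw [abs_mul]
      exact mul_le_mul (hA 0 μ) (Kerr.abs_sum_sum_mul_mul_le _ p p (hD μ)) (abs_nonneg _)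
        (by positivity)
    calc 2⁻¹ * |∑ μ, B.inverseMetric x 0 μ * ∑ α, ∑ β,
          fderiv ℝ (fun y ↦ B.inverseMetric y α β) x (E4.basisVector μ) * p α * p β|
        ≤ 2⁻¹ * ∑ μ, |B.inverseMetric x 0 μ * ∑ α, ∑ β,
          fderiv ℝ (fun y ↦ B.inverseMetric y α β) x (E4.basisVector μ) * p α * p β| := by
          gcongr; exact Finset.abs_sum_le_sum_abs _ _
      _ ≤ 2⁻¹ * ∑ μ : Fin 4, (1 + Φ) * (D * (∑ α, |p α|) * ∑ β, |p β|) := by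
          gcongr with μ _; exact hin μ
      _ = 2 * (1 + Φ) * D * (∑ α, |p α|) ^ 2 := by
          rw [Finset.sum_const, Finset.card_univ, Fintype.card_fin]; ring
      _ ≤ 2 * (1 + Φ) * D * (4 * S) := by gcongr
      _ = 8 * (1 + Φ) * D * S := by ring
  have hdef : deformationTerm B.inverseMetric w x =
      (∑ μ, (∑ ν, B.inverseMetric x μ ν * p ν) *
        ∑ β, fderiv ℝ (fun y ↦ B.inverseMetric y 0 β) x (E4.basisVector μ) * p β) -
      2⁻¹ * (∑ μ, fderiv ℝ (fun y ↦ B.inverseMetric y 0 μ) x (E4.basisVector μ)) *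
        (∑ α, ∑ β, B.inverseMetric x α β * p α * p β) -
      2⁻¹ * ∑ μ, B.inverseMetric x 0 μ * ∑ α, ∑ β,
        fderiv ℝ (fun y ↦ B.inverseMetric y α β) x (E4.basisVector μ) * p α * p β := rfl
  rw [hdef]
  calc _ ≤ |(∑ μ, (∑ ν, B.inverseMetric x μ ν * p ν) *
        ∑ β, fderiv ℝ (fun y ↦ B.inverseMetric y 0 β) x (E4.basisVector μ) * p β) -
      2⁻¹ * (∑ μ, fderiv ℝ (fun y ↦ B.inverseMetric y 0 μ) x (E4.basisVector μ)) *
        (∑ α, ∑ β, B.inverseMetric x α β * p α * p β)| +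
      |2⁻¹ * ∑ μ, B.inverseMetric x 0 μ * ∑ α, ∑ β,
        fderiv ℝ (fun y ↦ B.inverseMetric y α β) x (E4.basisVector μ) * p α * p β| :=
        abs_sub _ _
    _ ≤ (16 * (1 + Φ) * D * S + 8 * (1 + Φ) * D * S) + 8 * (1 + Φ) * D * S :=
        add_le_add ((abs_sub _ _).trans (add_le_add h1 h2)) h3
    _ = 32 * (1 + Φ) * D * S := by ring

end Background

end KerrSchild

end Literature.Geometry.Lorentzian

end
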